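/-
Copyright: fleet lead `ym-wcr-19609-p1` (seat prover-ym-wcr-19609-p1-g0-0), route `WeakCouplingRates`, crux
`BulkDominatesColdBoxW` (stmt-QuantumFields-19609), line `dlr-chessboard` (skeleton sha16 021c654069d76526).
-/
import Summits.QuantumFields.YangMills.Theorems.WeakCouplingRatesBulkDominatesColdBoxWDefs
import Literature.MathematicalPhysics.QuantumLattice.LatticeGaugeDLRCovarianceSplit

/-!
# Registered stub L3 `stub_dlrAssembly : DlrAssembly` of crux `BulkDominatesColdBoxW` (stmt-QuantumFields-19609) —
# the DLR law of total covariance through the cold box, with a crude-good / bad split of the boundary datum.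
# Part 1 of 2: PLUMBING (abstract total covariance, counting, torus fit, the bad set); part 2
# (`WeakCouplingRatesBulkDominatesColdBoxWStubDlrAssembly`) proves the stub by name.

WHAT.  `DlrAssembly` (module `WeakCouplingRatesBulkDominatesColdBoxWDefs`): for all real `A θ δ η₁ K` with `0 < A`, `0 < δ`,
`0 < η₁` and the window `K + 4δ + 2A < 2 + 2θ`,
`GoodBoundaryCovStable A θ δ η₁ → GoodBoundaryMeanSmooth A θ δ → PlaquetteLargeFieldRarity δ → BoxPolyFloor A θ K →
BulkDominatesBox (G := SU(2)) (fundamentalRep (Fin 2)) A θ` — the torus-state covariance of the `(1,2)`-plaquette cost and its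
time-translate by `T = ⌈β^A⌉` is, eventually in the torus size, `≥ (η₁/2) ×` the cold-wall box covariance `boxPlaqCov ρ β H T`,
`H = ⌈β^θ⌉`.  To be PROVED in part 2 (`stub_dlrAssembly`), by probability + DLR plumbing only; this part supplies steps 1, 3 and the
geometry of step 2:

1. **abstract law of total covariance with an exceptional event and a SAME-datum mean difference**
   (`total_covariance_lower_bound_sub`): for bounded measurable `h, k, q` (`|h|,|k| ≤ K₀`, `|q| ≤ K₀²`), an event `E` of mass
   `≤ p`, `q − hk ≥ θ ≥ 0` and `|k − h| ≤ ε` off `E`:  `θ − ε²/4 − (θ + 3K₀²)p ≤ ∫q − ∫h∫k`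
   (`∫hk − ∫h∫k = Var((h+k)/2) − ¼∫(k−h)² + ¼(∫(k−h))² ≥ −¼∫(k−h)²`);
2. **the DLR equations** of the torus Wilson state for the box `Λ = boxEdges 4 (2H+1)` (tree
   `wilsonExpectation_toTorusObservable_eq`, injectivity of the torus projection on `[−M, M]⁴`, `M = 2H + T + 2`, for torus sides
   `L + 1 > 2M`) applied to `c_p`, `c_{p'}`, `c_p c_{p'}` (`p = (bc; 1,2)`, `p' = p + Te₀`, `bc = boxCentre H`), and translation
   invariance of the torus state (`integral_comp_configShift_torusLift`) moving the leaf's origin-based pair `plaqCost0 · plaqCost0 ∘ α_T`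
   to the box-centred pair;
3. **the good/bad split**: `Bad = ⋃_{x ∈ [−1,2H+1]⁴, i<j} {β^{2δ−1} < c_{x,ij}}` (a finite union, measurable), off which the lifted datum
   is `CrudeGood` (so L1a gives `q − hk ≥ η₁·boxPlaqCov` and L1b gives `|k − h| ≤ |K₁| β^{2δ−1} T/H`), and whose torus mass is
   `≤ 6(2H+3)⁴ e^{−β^δ}` by the union bound and L2 (`PlaquetteLargeFieldRarity δ`, all sites and planes, eventually in `L`);
4. **window arithmetic**: `ε²/4 ≤ K₁² β^{4δ−2+2A−2θ} = o(β^{−K})` (the window), `6(2H+3)⁴e^{−β^δ}·(32η₁+48) = o(β^{−K})`, and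
   `β^{−K} ≤ boxPlaqCov` (`BoxPolyFloor`) give `Cov_torus ≥ η₁X − ¼η₁X − ¼η₁X = (η₁/2)·X`, `X = boxPlaqCov`.

WHAT THIS IS NOT.  No analysis: the two analytic inputs (L1a, L1b) and BOX_W/FLOOR (`BoxPolyFloor`) are hypotheses.  NOT a claim
about the mass gap.

References: H.-O. Georgii, *Gibbs Measures and Phase Transitions* (2011) Prop. 2.5, Thm. 4.17; S. Friedli, Y. Velenik (2017) Lemma 6.7;
E. Seiler, LNP 159 (1982) Ch. 2; R. Durrett (2019) §4.1 (law of total covariance).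
-/

set_option autoImplicit false

noncomputable section

open MeasureTheory Filter Topology
open Literature.MathematicalPhysics
open Literature.MathematicalPhysics.QuantumFieldTheory
open Literature.MathematicalPhysics.QuantumLattice
open Literature.Probability.LatticeModels (Torus.proj box mem_box)

namespace Summit.QuantumFields.YangMills.Theorems.WeakCouplingRates

/-! ### §1. The abstract law of total covariance with a same-datum mean difference -/

/-- **Law of total covariance with an exceptional event, same-datum form.**  On a probability space let `h, k, q` be measurable
with `|h|, |k| ≤ K₀`, `|q| ≤ K₀²` (think: the conditional expectations of `X`, `Y`, `XY` given a sub-σ-algebra), `E` an event of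
mass `≤ p`, and suppose that off `E` the conditional covariance is `q − hk ≥ θ ≥ 0` and the two conditional means differ by
`|k − h| ≤ ε`.  Then `θ − ε²/4 − (θ + 3K₀²)p ≤ ∫ q − ∫ h · ∫ k` — the mean of the conditional covariances is `≥ θ − (θ + 2K₀²)p`,
and the covariance of the conditional means is `∫hk − ∫h∫k = Var((h+k)/2) − ¼∫(k−h)² + ¼(∫(k−h))² ≥ −¼∫(k−h)² ≥ −ε²/4 − K₀²p`
(Durrett 2019 §4.1). [folklore] -/
theorem total_covariance_lower_bound_sub {Ω : Type*} [MeasurableSpace Ω] {μ : Measure Ω} [IsProbabilityMeasure μ]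
    {E : Set Ω} (hE : MeasurableSet E) {h k q : Ω → ℝ} (hhm : Measurable h) (hkm : Measurable k) (hqm : Measurable q)
    {K₀ θ ε p : ℝ} (hhK : ∀ ω, |h ω| ≤ K₀) (hkK : ∀ ω, |k ω| ≤ K₀) (hqK : ∀ ω, |q ω| ≤ K₀ ^ 2) (hθ : 0 ≤ θ)
    (hlow : ∀ ω, ω ∉ E → θ ≤ q ω - h ω * k ω) (hdiff : ∀ ω, ω ∉ E → |k ω - h ω| ≤ ε) (hμE : μ.real E ≤ p) :
    θ - ε ^ 2 / 4 - (θ + 3 * K₀ ^ 2) * p ≤ (∫ ω, q ω ∂μ) - (∫ ω, h ω ∂μ) * ∫ ω, k ω ∂μ := by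
  obtain ⟨ω₁⟩ := nonempty_of_isProbabilityMeasure μ
  have hK : 0 ≤ K₀ := (abs_nonneg _).trans (hhK ω₁)
  have bdd : ∀ {f : Ω → ℝ} (C : ℝ), Measurable f → (∀ ω, |f ω| ≤ C) → Integrable f μ := fun C hf hC =>
    Integrable.of_bound hf.aestronglyMeasurable C (ae_of_all _ fun ω => by simpa [Real.norm_eq_abs] using hC ω)
  have hhkb : ∀ ω, |h ω * k ω| ≤ K₀ ^ 2 := fun ω => by
    rw [abs_mul, sq]; exact mul_le_mul (hhK ω) (hkK ω) (abs_nonneg _) hK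
  have hhi : Integrable h μ := bdd K₀ hhm hhK
  have hki : Integrable k μ := bdd K₀ hkm hkK
  have hqi : Integrable q μ := bdd _ hqm hqK
  have hhki : Integrable (fun ω => h ω * k ω) μ := bdd _ (hhm.mul hkm) hhkb
  have hpE : μ.real E ≤ p := hμE
  have hE0 : 0 ≤ μ.real E := measureReal_nonneg
  -- Step 1: the mean of the conditional covariances
  have hstep1 : θ - (θ + 2 * K₀ ^ 2) * μ.real E ≤ (∫ ω, q ω ∂μ) - ∫ ω, h ω * k ω ∂μ := by
    rw [← integral_sub hqi hhki]
    have hpt : ∀ ω, θ - (θ + 2 * K₀ ^ 2) * E.indicator (fun _ => (1 : ℝ)) ω ≤ q ω - h ω * k ω := by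
      intro ω
      by_cases hω : ω ∈ E
      · rw [Set.indicator_of_mem hω, mul_one]
        have h1 := hqK ω
        have h2 := hhkb ω
        rw [abs_le] at h1 h2
        linarith
      · rw [Set.indicator_of_notMem hω, mul_zero, sub_zero]
        exact hlow ω hω
    have hint : Integrable (fun ω => θ - (θ + 2 * K₀ ^ 2) * E.indicator (fun _ => (1 : ℝ)) ω) μ :=
      (integrable_const _).sub (((integrable_const _).indicator hE).const_mul _)
    calc θ - (θ + 2 * K₀ ^ 2) * μ.real E
        = ∫ ω, (θ - (θ + 2 * K₀ ^ 2) * E.indicator (fun _ => (1 : ℝ)) ω) ∂μ := by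
          rw [integral_sub (integrable_const _) (((integrable_const _).indicator hE).const_mul _),
            integral_const_mul, integral_indicator_const _ hE, integral_const]
          simp
      _ ≤ ∫ ω, (q ω - h ω * k ω) ∂μ := integral_mono hint (hqi.sub hhki) hpt
  -- Step 2: the covariance of the conditional means is `≥ -¼ ∫ (k - h)²`
  set m : Ω → ℝ := fun ω => (h ω + k ω) / 2 with hm
  set D : Ω → ℝ := fun ω => k ω - h ω with hD
  have hmm : Measurable m := (hhm.add hkm).div_const 2
  have hDm : Measurable D := hkm.sub hhm
  have hmK : ∀ ω, |m ω| ≤ K₀ := fun ω => by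
    rw [hm]; dsimp only
    rw [abs_div, abs_two]
    have := abs_add_le (h ω) (k ω)
    linarith [hhK ω, hkK ω]
  have hDK : ∀ ω, |D ω| ≤ 2 * K₀ := fun ω => by
    rw [hD]; dsimp only
    have := abs_sub (k ω) (h ω)
    linarith [hhK ω, hkK ω]
  have hmi : Integrable m μ := bdd K₀ hmm hmK
  have hDi : Integrable D μ := bdd _ hDm hDK
  have hm2i : Integrable (fun ω => m ω ^ 2) μ := bdd (K₀ ^ 2) (hmm.pow_const 2) fun ω => by
    rw [abs_pow, sq_abs, ← sq_abs]; exact pow_le_pow_left₀ (abs_nonneg _) (hmK ω) 2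
  have hD2i : Integrable (fun ω => D ω ^ 2) μ := bdd ((2 * K₀) ^ 2) (hDm.pow_const 2) fun ω => by
    rw [abs_pow, sq_abs, ← sq_abs]; exact pow_le_pow_left₀ (abs_nonneg _) (hDK ω) 2
  -- `Var m ≥ 0` in raw form
  have hvar : (∫ ω, m ω ∂μ) ^ 2 ≤ ∫ ω, m ω ^ 2 ∂μ := by
    set c := ∫ ω, m ω ∂μ with hc
    have h0 : 0 ≤ ∫ ω, (m ω - c) ^ 2 ∂μ := integral_nonneg fun ω => sq_nonneg _
    have hexp : ∫ ω, (m ω - c) ^ 2 ∂μ = (∫ ω, m ω ^ 2 ∂μ) - 2 * c * (∫ ω, m ω ∂μ) + c ^ 2 := by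
      have e : (fun ω => (m ω - c) ^ 2) = fun ω => m ω ^ 2 - 2 * c * m ω + c ^ 2 := by
        funext ω; ring
      have hf : Integrable (fun ω => m ω ^ 2 - 2 * c * m ω) μ := hm2i.sub (hmi.const_mul _)
      rw [e, integral_add hf (integrable_const _), integral_sub hm2i (hmi.const_mul _),
        integral_const_mul, integral_const]
      simp
    rw [hexp, ← hc] at h0
    nlinarith
  have hcovm : -(1 / 4 : ℝ) * ∫ ω, D ω ^ 2 ∂μ ≤ (∫ ω, h ω * k ω ∂μ) - (∫ ω, h ω ∂μ) * ∫ ω, k ω ∂μ := by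
    have e1 : (fun ω => h ω * k ω) = fun ω => m ω ^ 2 - (1 / 4 : ℝ) * D ω ^ 2 := by
      funext ω; simp only [hm, hD]; ring
    have e2 : h = fun ω => m ω - (1 / 2 : ℝ) * D ω := by funext ω; simp only [hm, hD]; ring
    have e3 : k = fun ω => m ω + (1 / 2 : ℝ) * D ω := by funext ω; simp only [hm, hD]; ring
    have i1 : ∫ ω, h ω * k ω ∂μ = (∫ ω, m ω ^ 2 ∂μ) - (1 / 4 : ℝ) * ∫ ω, D ω ^ 2 ∂μ := by
      rw [e1, integral_sub hm2i (hD2i.const_mul _), integral_const_mul]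
    have i2 : ∫ ω, h ω ∂μ = (∫ ω, m ω ∂μ) - (1 / 2 : ℝ) * ∫ ω, D ω ∂μ := by
      conv_lhs => rw [e2]
      rw [integral_sub hmi (hDi.const_mul _), integral_const_mul]
    have i3 : ∫ ω, k ω ∂μ = (∫ ω, m ω ∂μ) + (1 / 2 : ℝ) * ∫ ω, D ω ∂μ := by
      conv_lhs => rw [e3]
      rw [integral_add hmi (hDi.const_mul _), integral_const_mul]
    rw [i1, i2, i3]
    nlinarith [sq_nonneg (∫ ω, D ω ∂μ)]
  -- Step 3: `∫ D² ≤ ε² + 4 K₀² μ(E)`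
  have hD2 : ∫ ω, D ω ^ 2 ∂μ ≤ ε ^ 2 + 4 * K₀ ^ 2 * μ.real E := by
    have hpt : ∀ ω, D ω ^ 2 ≤ ε ^ 2 + 4 * K₀ ^ 2 * E.indicator (fun _ => (1 : ℝ)) ω := by
      intro ω
      by_cases hω : ω ∈ E
      · rw [Set.indicator_of_mem hω, mul_one]
        have h1 : D ω ^ 2 ≤ (2 * K₀) ^ 2 := by
          rw [← sq_abs]; exact pow_le_pow_left₀ (abs_nonneg _) (hDK ω) 2
        nlinarith [sq_nonneg ε]
      · rw [Set.indicator_of_notMem hω, mul_zero, add_zero, ← sq_abs]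
        have hε0 : 0 ≤ ε := (abs_nonneg _).trans (hdiff ω hω)
        exact pow_le_pow_left₀ (abs_nonneg _) (hdiff ω hω) 2
    calc ∫ ω, D ω ^ 2 ∂μ ≤ ∫ ω, (ε ^ 2 + 4 * K₀ ^ 2 * E.indicator (fun _ => (1 : ℝ)) ω) ∂μ :=
          integral_mono hD2i ((integrable_const _).add (((integrable_const _).indicator hE).const_mul _)) hpt
      _ = ε ^ 2 + 4 * K₀ ^ 2 * μ.real E := by
          rw [integral_add (integrable_const _) (((integrable_const _).indicator hE).const_mul _), integral_const_mul,
            integral_indicator_const _ hE, integral_const]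
          simp
  -- assemble
  have hK2 : 0 ≤ K₀ ^ 2 := sq_nonneg _
  nlinarith [mul_le_mul_of_nonneg_left hpE (by positivity : (0 : ℝ) ≤ θ + 3 * K₀ ^ 2)]

/-! ### §2. Elementary asymptotics and counting -/

/-- `β^s · exp(−β^δ) → 0` as `β → ∞`, for every real `s` and `δ > 0`. [folklore] -/
theorem tendsto_rpow_mul_exp_neg_rpow (s : ℝ) {δ : ℝ} (hδ : 0 < δ) :
    Tendsto (fun β : ℝ => β ^ s * Real.exp (-(β ^ δ))) atTop (𝓝 0) := by
  have h1 : Tendsto (fun β : ℝ => β ^ δ) atTop atTop := tendsto_rpow_atTop hδ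
  have h2 := tendsto_rpow_mul_exp_neg_mul_atTop_nhds_zero (s / δ) 1 one_pos
  refine (h2.comp h1).congr' ?_
  filter_upwards [eventually_gt_atTop 0] with β hβ
  simp only [Function.comp_def]
  rw [← Real.rpow_mul hβ.le, mul_div_cancel₀ _ hδ.ne', neg_mul, one_mul]

/-- The corona range `[−1, 2H+1]⁴` of the box `[0,2H]⁴` has `(2H+3)⁴` sites. [folklore] -/
theorem card_coronaSites (H : ℕ) :
    (Fintype.piFinset fun _ : Fin 4 => Finset.Icc (-1 : ℤ) (2 * (H : ℤ) + 1)).card = (2 * H + 3) ^ 4 := by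
  rw [Fintype.card_piFinset, Finset.prod_const, Finset.card_univ, Fintype.card_fin, Int.card_Icc]
  have e : (2 * (H : ℤ) + 1 + 1 - -1).toNat = 2 * H + 3 := by omega
  rw [e]

/-- There are six coordinate planes `i < j` in `ℤ⁴`. [folklore] -/
theorem card_planePairs : ((Finset.univ : Finset (Fin 4 × Fin 4)).filter fun q => q.1 < q.2).card = 6 := by decide

/-! ### §3. The two plaquettes, their costs, and the torus fit of the box -/

/-- The plaquette cost `plaqCostAt ρ x 1 2` is a cylinder observable on the four edges of `(x; 1, 2)`. [folklore] -/
theorem isCylinder_plaqCostAt12 (x : Literature.Probability.LatticeModels.Site 4) :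
    IsCylinder (plaqCostAt (G := (Matrix.specialUnitaryGroup (Fin 2) ℂ)) (fundamentalRep (Fin 2)) x 1 2) (plaquetteEdges ((x, ⟨(1, 2), by decide⟩) : ZdPlaquette 4)) := by
  intro U V hUV
  have h := isCylinder_plaquetteObs (G := (Matrix.specialUnitaryGroup (Fin 2) ℂ)) (fundamentalRep (Fin 2)) ((x, ⟨(1, 2), by decide⟩) : ZdPlaquette 4) hUV
  simp only [plaqCostAt]
  exact congrArg (fun r : ℝ => ((2 : ℕ) : ℝ) - r) h

/-- `plaqCostAt ρ x i j` is continuous. [folklore] -/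
theorem continuous_plaqCostAt (x : Literature.Probability.LatticeModels.Site 4) (i j : Fin 4) :
    Continuous (plaqCostAt (G := (Matrix.specialUnitaryGroup (Fin 2) ℂ)) (fundamentalRep (Fin 2)) x i j) := by
  show Continuous fun U : LGConfig 4 (Matrix.specialUnitaryGroup (Fin 2) ℂ) => ((2 : ℕ) : ℝ) - plaquetteObs (fundamentalRep (Fin 2)) x i j U
  exact continuous_const.sub (continuous_plaquetteObs _ (continuous_fundamentalRep (Fin 2)) x i j)

/-- `SU(2)` is second countable (a closed subgroup of `M₂(ℂ)`). [folklore] -/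
theorem secondCountableTopology_su2 : SecondCountableTopology (Matrix.specialUnitaryGroup (Fin 2) ℂ) :=
  ((fundamentalLatticeRep 2).continuous.isClosedEmbedding (fundamentalLatticeRep 2).injective).isEmbedding.secondCountableTopology

/-- `plaqCostAt ρ x i j` is measurable. [folklore] -/
theorem measurable_plaqCostAt (x : Literature.Probability.LatticeModels.Site 4) (i j : Fin 4) :
    Measurable (plaqCostAt (G := (Matrix.specialUnitaryGroup (Fin 2) ℂ)) (fundamentalRep (Fin 2)) x i j) := by
  haveI := secondCountableTopology_su2
  exact (continuous_plaqCostAt x i j).measurable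

/-- `|plaqCostAt ρ x i j| ≤ 4` for `SU(2)` (`|Re tr U| ≤ 2`). [folklore] -/
theorem abs_plaqCostAt_le (x : Literature.Probability.LatticeModels.Site 4) (i j : Fin 4) (U : LGConfig 4 (Matrix.specialUnitaryGroup (Fin 2) ℂ)) :
    |plaqCostAt (fundamentalRep (Fin 2)) x i j U| ≤ 4 := by
  have h := abs_plaquetteObs_le_holds (G := (Matrix.specialUnitaryGroup (Fin 2) ℂ)) (fundamentalRep (Fin 2)) fundamentalRep_mem_unitaryGroup x i j U
  simp only [plaqCostAt, Nat.cast_ofNat] at h ⊢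
  have := abs_sub (2 : ℝ) (plaquetteObs (fundamentalRep (Fin 2)) x i j U)
  rw [abs_two] at this
  linarith

/-- Products of two plaquette costs are bounded by `4²`. [folklore] -/
theorem abs_plaqCostAt_mul_le (x y : Literature.Probability.LatticeModels.Site 4) (i j : Fin 4) (U : LGConfig 4 (Matrix.specialUnitaryGroup (Fin 2) ℂ)) :
    |plaqCostAt (fundamentalRep (Fin 2)) x i j U * plaqCostAt (fundamentalRep (Fin 2)) y i j U| ≤ 4 ^ 2 := by
  rw [abs_mul, sq]
  exact mul_le_mul (abs_plaqCostAt_le x i j U) (abs_plaqCostAt_le y i j U) (abs_nonneg _) (by norm_num)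

/-- **Torus fit.** Every edge of the box `Λ = boxEdges 4 (2H+1)`, of its collar, and of the two plaquettes `(bc; 1,2)`,
`(bc + Te₀; 1,2)` (`bc = boxCentre H`) is based in `[−M, M]⁴`, `M = 2H + T + 2`. [folklore] -/
theorem fst_mem_box_of_mem_boxUnion {H T : ℕ} {e : QuantumLattice.ZdEdge 4}
    (he : e ∈ AxialGauge.boxEdges 4 (2 * H + 1) ∪
        (plaquetteEdges ((boxCentre H, ⟨(1, 2), by decide⟩) : ZdPlaquette 4) ∪
          plaquetteEdges ((boxCentre H + Pi.single 0 (T : ℤ), ⟨(1, 2), by decide⟩) : ZdPlaquette 4)) ∪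
        (plaquettesTouching (AxialGauge.boxEdges 4 (2 * H + 1))).biUnion plaquetteEdges) :
    e.1 ∈ box 4 (2 * H + T + 2) := by
  rw [mem_box]
  intro k
  have hM : ((2 * H + T + 2 : ℕ) : ℤ) = 2 * (H : ℤ) + T + 2 := by push_cast; ring
  rw [hM]
  rcases Finset.mem_union.1 he with he | he
  · rcases Finset.mem_union.1 he with he | he
    · obtain ⟨x, i⟩ := e
      have h := (AxialGauge.mem_boxEdges_iff.1 he).1 k
      simp only
      constructor <;> push_cast at h <;> omega
    · rcases Finset.mem_union.1 he with he | he
      · have h := coord_of_mem_plaquetteEdges he k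
        simp only [boxCentre] at h
        constructor <;> omega
      · have h := coord_of_mem_plaquetteEdges he k
        simp only [boxCentre, Pi.add_apply, Pi.single_apply] at h
        split_ifs at h <;> constructor <;> omega
  · obtain ⟨e', he', hn⟩ := exists_near_of_mem_collar he
    obtain ⟨x, i⟩ := e'
    have h := (AxialGauge.mem_boxEdges_iff.1 he').1 k
    have hk := hn k
    simp only at hk
    constructor <;> push_cast at h <;> omega


/-! ### §4. The bad boundary data: a finite union of single-plaquette large-field events -/

/-- Off the bad set the datum is crude-good. [folklore] -/
theorem crudeGood_of_not_mem_badSet {β δ : ℝ} {H : ℕ} {W : LGConfig 4 (Matrix.specialUnitaryGroup (Fin 2) ℂ)}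
    (hW : W ∉ ⋃ z ∈ (Fintype.piFinset fun _ : Fin 4 => Finset.Icc (-1 : ℤ) (2 * (H : ℤ) + 1)) ×ˢ
        ((Finset.univ : Finset (Fin 4 × Fin 4)).filter fun q => q.1 < q.2),
      {W : LGConfig 4 (Matrix.specialUnitaryGroup (Fin 2) ℂ) |
        β ^ (2 * δ - 1) < plaqCostAt (fundamentalRep (Fin 2)) z.1 z.2.1 z.2.2 W}) :
    CrudeGood β δ H W := by
  intro x hx i j hij
  by_contra hlt
  rw [not_le] at hlt
  refine hW (Set.mem_iUnion₂.2 ⟨(x, (i, j)), ?_, hlt⟩)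
  exact Finset.mem_product.2 ⟨by simpa [Fintype.mem_piFinset] using hx, by simpa using hij⟩

/-- The bad set is measurable. [folklore] -/
theorem measurableSet_badSet (β δ : ℝ) (H : ℕ) :
    MeasurableSet (⋃ z ∈ (Fintype.piFinset fun _ : Fin 4 => Finset.Icc (-1 : ℤ) (2 * (H : ℤ) + 1)) ×ˢ ((Finset.univ : Finset (Fin 4 × Fin 4)).filter fun q => q.1 < q.2),
        {W : LGConfig 4 (Matrix.specialUnitaryGroup (Fin 2) ℂ) | β ^ (2 * δ - 1) < plaqCostAt (fundamentalRep (Fin 2)) z.1 z.2.1 z.2.2 W}) :=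
  Finset.measurableSet_biUnion _ fun z _ => measurableSet_lt measurable_const (measurable_plaqCostAt z.1 z.2.1 z.2.2)

/-- The torus mass of a single-plaquette large-field event, read through the periodic lift, is the Wilson expectation of the
indicator observable of the line's predicate `PlaquetteLargeFieldRarity`. [folklore] -/
theorem measureReal_setOf_le_plaqCostAt_eq (β t : ℝ) (L : ℕ) (x : Literature.Probability.LatticeModels.Site 4) (i j : Fin 4) :
    (wilsonMeasure (d := 4) (L := L + 1) (fundamentalRep (Fin 2)) β).real
        {U : GaugeConfig 4 (L + 1) (Matrix.specialUnitaryGroup (Fin 2) ℂ) | t ≤ plaqCostAt (fundamentalRep (Fin 2)) x i j (torusLift (L + 1) U)} =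
      wilsonExpectation (L := L + 1) (fundamentalRep (Fin 2)) β
        (toTorusObservable (L + 1) fun U : LGConfig 4 (Matrix.specialUnitaryGroup (Fin 2) ℂ) =>
          if t ≤ plaqCostAt (fundamentalRep (Fin 2)) x i j U then (1 : ℝ) else 0) := by
  have hSm : MeasurableSet {U : GaugeConfig 4 (L + 1) (Matrix.specialUnitaryGroup (Fin 2) ℂ) |
      t ≤ plaqCostAt (fundamentalRep (Fin 2)) x i j (torusLift (L + 1) U)} :=
    measurableSet_le measurable_const ((measurable_plaqCostAt x i j).comp (measurable_torusLift _))
  rw [← integral_indicator_one hSm]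
  unfold wilsonExpectation
  congr 1

/-- **Union bound for the bad set.** If every single-plaquette large-field indicator has Wilson expectation `≤ e^{−β^δ}` on the torus
`(L+1)⁴` (the line's L2 at this `β` and `L`), the lifted bad set has torus mass `≤ 6(2H+3)⁴ e^{−β^δ}` — uniformly in `L`. [folklore] -/
theorem measureReal_badSet_le {β δ : ℝ} {H L : ℕ}
    (hL2 : ∀ (x : Literature.Probability.LatticeModels.Site 4) (i j : Fin 4), i < j →
      wilsonExpectation (L := L + 1) (fundamentalRep (Fin 2)) β
          (toTorusObservable (L + 1) fun U : LGConfig 4 (Matrix.specialUnitaryGroup (Fin 2) ℂ) =>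
            if β ^ (2 * δ - 1) ≤ plaqCostAt (fundamentalRep (Fin 2)) x i j U then (1 : ℝ) else 0) ≤
        Real.exp (-(β ^ δ))) :
    (wilsonMeasure (d := 4) (L := L + 1) (fundamentalRep (Fin 2)) β).real
        {U : GaugeConfig 4 (L + 1) (Matrix.specialUnitaryGroup (Fin 2) ℂ) | torusLift (L + 1) U ∈
          (⋃ z ∈ (Fintype.piFinset fun _ : Fin 4 => Finset.Icc (-1 : ℤ) (2 * (H : ℤ) + 1)) ×ˢ ((Finset.univ : Finset (Fin 4 × Fin 4)).filter fun q => q.1 < q.2),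
            {W : LGConfig 4 (Matrix.specialUnitaryGroup (Fin 2) ℂ) | β ^ (2 * δ - 1) < plaqCostAt (fundamentalRep (Fin 2)) z.1 z.2.1 z.2.2 W})} ≤
      ((6 * (2 * H + 3) ^ 4 : ℕ) : ℝ) * Real.exp (-(β ^ δ)) := by
  haveI := isProbabilityMeasure_wilsonMeasure (d := 4) (L := L + 1) (G := (Matrix.specialUnitaryGroup (Fin 2) ℂ)) (fundamentalRep (Fin 2))
    (continuous_fundamentalRep (Fin 2)) β
  set μ := wilsonMeasure (d := 4) (L := L + 1) (fundamentalRep (Fin 2)) β with hμ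
  have hset : {U : GaugeConfig 4 (L + 1) (Matrix.specialUnitaryGroup (Fin 2) ℂ) | torusLift (L + 1) U ∈
          (⋃ z ∈ (Fintype.piFinset fun _ : Fin 4 => Finset.Icc (-1 : ℤ) (2 * (H : ℤ) + 1)) ×ˢ ((Finset.univ : Finset (Fin 4 × Fin 4)).filter fun q => q.1 < q.2),
            {W : LGConfig 4 (Matrix.specialUnitaryGroup (Fin 2) ℂ) | β ^ (2 * δ - 1) < plaqCostAt (fundamentalRep (Fin 2)) z.1 z.2.1 z.2.2 W})} =
      ⋃ z ∈ (Fintype.piFinset fun _ : Fin 4 => Finset.Icc (-1 : ℤ) (2 * (H : ℤ) + 1)) ×ˢ ((Finset.univ : Finset (Fin 4 × Fin 4)).filter fun q => q.1 < q.2),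
        {U : GaugeConfig 4 (L + 1) (Matrix.specialUnitaryGroup (Fin 2) ℂ) | β ^ (2 * δ - 1) < plaqCostAt (fundamentalRep (Fin 2)) z.1 z.2.1 z.2.2 (torusLift (L + 1) U)} := by
    ext U
    simp only [Set.mem_setOf_eq, Set.mem_iUnion, exists_prop]
  rw [hset]
  refine (measureReal_biUnion_finset_le _ _).trans ?_
  have hterm : ∀ z ∈ (Fintype.piFinset fun _ : Fin 4 => Finset.Icc (-1 : ℤ) (2 * (H : ℤ) + 1)) ×ˢ ((Finset.univ : Finset (Fin 4 × Fin 4)).filter fun q => q.1 < q.2),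
      μ.real {U : GaugeConfig 4 (L + 1) (Matrix.specialUnitaryGroup (Fin 2) ℂ) | β ^ (2 * δ - 1) <
          plaqCostAt (fundamentalRep (Fin 2)) z.1 z.2.1 z.2.2 (torusLift (L + 1) U)} ≤ Real.exp (-(β ^ δ)) := by
    intro z hz
    have hij : z.2.1 < z.2.2 := by
      have := (Finset.mem_product.1 hz).2
      simpa using this
    calc μ.real {U : GaugeConfig 4 (L + 1) (Matrix.specialUnitaryGroup (Fin 2) ℂ) | β ^ (2 * δ - 1) <
            plaqCostAt (fundamentalRep (Fin 2)) z.1 z.2.1 z.2.2 (torusLift (L + 1) U)}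
        ≤ μ.real {U : GaugeConfig 4 (L + 1) (Matrix.specialUnitaryGroup (Fin 2) ℂ) | β ^ (2 * δ - 1) ≤
            plaqCostAt (fundamentalRep (Fin 2)) z.1 z.2.1 z.2.2 (torusLift (L + 1) U)} :=
          measureReal_mono (fun U (hU : β ^ (2 * δ - 1) < _) => le_of_lt hU)
      _ = _ := measureReal_setOf_le_plaqCostAt_eq β _ L z.1 z.2.1 z.2.2
      _ ≤ Real.exp (-(β ^ δ)) := hL2 z.1 z.2.1 z.2.2 hij
  refine (Finset.sum_le_sum hterm).trans ?_
  rw [Finset.sum_const, nsmul_eq_mul, Finset.card_product, card_coronaSites, card_planePairs]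
  push_cast
  ring_nf
  rfl

end Summit.QuantumFields.YangMills.Theorems.WeakCouplingRates
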